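import Summits.PneNP.PneNP.Theses.ExpanderLinearGenerators
import Summits.PneNP.PneNP.Theorems.ExpanderLinearGeneratorsExpansionForcesDepthFregeSizeTseitin
import Literature.Computability.MetaComplexity.ExpanderTreewidth
import Literature.Combinatorics.SimpleGraph.TreeDecomposition

/-!
# PneNP / ExpanderLinearGenerators — the expansion-scale law at column weight two from ANY weak
# treewidth bound (stmt-PneNP-11442, slice; companion of the GIRS-conditional slice)

Route `PneNP/ExpanderLinearGenerators`, crux stmt-PneNP-11442
(`Summit.PneNP.PneNP.Theses.ExpanderLinearGenerators.ExpansionForcesDepthFregeSize`). The sibling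
file `…ExpansionForcesDepthFregeSizeTseitin` derives the column-weight-two (graph Tseitin,
connected) slice of the crux from the Galesi–Itsykson–Riazanov–Sofronova bound with the exponent
`tw^{c/d}`. The crux only asks for SOME `ε(ℓ, d) > 0`, so a treewidth bound of the weak shape
"`∀ d ∃ ε > 0 ∃ t₀`: connected graph Tseitin systems of treewidth `t ≥ t₀` need depth-`d` size
`≥ 2^{t^ε}`" suffices — and that weak shape is what the tree now proves WITHOUT Håstad's switching
lemma, from the polynomial excluded-grid theorem alone
(`Literature.Computability.MetaComplexity.tseitin_treewidth_depthFrege_lowerBound_of_wall`, via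
the unconditional weak grid theorem `gridSystem_depthFrege_lowerBound` and the GIRS reduction
`exists_gridRefutation`).

* `expansionForcesDepthFregeSize_tseitin_of_weakTreewidthBound` — the column-weight-two connected
  slice of `ExpansionForcesDepthFregeSize` from any weak treewidth bound: `(r, 3/4 · ℓ)`-boundary
  expansion of a boundaryless family forces `tw + 1 ≥ 3(r-1)/8`
  (`mul_le_mul_treewidth_of_isBoundaryExpander`), so `tw ≥ r/4` for `r ≥ 16` and
  `r^{ε/2} ≤ (r/4)^ε ≤ tw^ε`.

References: N. Galesi, D. Itsykson, A. Riazanov, A. Sofronova, APAL 174 (2023), Thm. 18;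
C. Chekuri, J. Chuzhoy, *Polynomial bounds for the grid-minor theorem*, J. ACM 63 (2016);
J. Chuzhoy, Z. Tan, JCTB 146 (2021), Thm. 1.1; J. Krajíček, *Proof complexity* (CUP 2019), §13.4,
Problem 19.4.5.
-/

namespace Summit.PneNP.PneNP.Theorems

set_option linter.dupNamespace false -- `Summit.PneNP.PneNP.…`: summit = sub-problem (D-0017)

open Finset Literature.Computability.MetaComplexity Literature.Computability.Complexity
  Literature.Combinatorics.SimpleGraph

/-- **The column-weight-two slice of the expansion-scale law, from any weak treewidth bound.**
Assume that for every depth `d` there are `ε > 0` and `t₀` such that every depth-`d`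
`textbookFrege` proof of `¬(sumEncoding 1 E)`, for a system `E` over `𝔽₂` in which every variable
occurs in exactly two rows or none and whose row graph `G` is connected with `tw(G) ≥ t₀`, has
size `≥ 2^{tw(G)^ε}`. Then for every locality `ℓ ≥ 1` and depth `d` there are `ε' > 0` and `R`
such that for every `r ≥ R`, every such system which is `ℓ`-sparse, unsolvable and whose row
supports form an `(r, 3/4 · ℓ)`-boundary expander forces depth-`d` proofs of size `≥ 2^{r^{ε'}}` —
the conclusion of `ExpansionForcesDepthFregeSize` on this class (`ε' = ε/2`, `R = max 16 (8t₀+20)`).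
[cite: GalesiEtAl2023, Theorem 18 (the treewidth form of the bound)] -/
theorem expansionForcesDepthFregeSize_tseitin_of_weakTreewidthBound
    (hweak : ∀ d : ℕ, ∃ ε : ℝ, 0 < ε ∧ ∃ t₀ : ℕ, ∀ (n m : ℕ) (E : Fin m → LinEqMod 2 n)
      (G : SimpleGraph (Fin m)),
      (∀ j : Fin n, (univ.filter fun i => j ∈ (E i).supp).card = 2 ∨
        (univ.filter fun i => j ∈ (E i).supp).card = 0) →
      (∀ i i' : Fin m, G.Adj i i' ↔ i ≠ i' ∧ ((E i).supp ∩ (E i').supp).Nonempty) →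
      G.Connected → t₀ ≤ treewidth G →
      ∀ π : List (PropForm ℕ),
        textbookFrege.IsDepthProofOf d π (PropForm.neg (PropForm.ofCNF (sumEncoding 1 E))) →
          (2 : ℝ) ^ ((treewidth G : ℝ) ^ ε) ≤ (proofSize π : ℝ)) :
    ∀ (ℓ d : ℕ), 1 ≤ ℓ → ∃ ε : ℝ, 0 < ε ∧ ∃ R : ℝ, ∀ r : ℝ, R ≤ r →
      ∀ (n m : ℕ) (E : Fin m → LinEqMod 2 n), (∀ i, (E i).supp.card ≤ ℓ) →
      IsBoundaryExpander (fun i => (E i).supp.map Fin.valEmbedding) r (3 / 4 * ℓ) →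
      ¬ SystemSat E Finset.univ →
      (∀ j : Fin n, (univ.filter fun i => j ∈ (E i).supp).card = 2 ∨
        (univ.filter fun i => j ∈ (E i).supp).card = 0) →
      ∀ G : SimpleGraph (Fin m),
        (∀ i i' : Fin m, G.Adj i i' ↔ i ≠ i' ∧ ((E i).supp ∩ (E i').supp).Nonempty) →
        G.Connected →
      ∀ π : List (PropForm ℕ),
        textbookFrege.IsDepthProofOf d π (PropForm.neg (PropForm.ofCNF (sumEncoding 1 E))) →
          (2 : ℝ) ^ (r ^ ε) ≤ (proofSize π : ℝ) := by
  classical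
  intro ℓ d hℓ
  obtain ⟨ε, hε, t₀, Ht⟩ := hweak d
  refine ⟨ε / 2, by positivity, max 16 (8 * t₀ + 20), fun r hr n m E hsparse hexp _ htwo G hG
    hconn π hπ => ?_⟩
  have hr16 : (16 : ℝ) ≤ r := le_trans (le_max_left _ _) hr
  have hrt : (8 * t₀ + 20 : ℝ) ≤ r := le_trans (le_max_right _ _) hr
  -- the system is boundaryless, hence its row graph has treewidth ≥ 3(r-1)/8 - 1
  haveI : Nonempty (Fin m) := hconn.nonempty
  set S : Fin m → Finset ℕ := fun i => (E i).supp.map Fin.valEmbedding with hS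
  have hℓ' : ∀ i, (S i).card ≤ ℓ := fun i => by
    simp only [hS, Finset.card_map]; exact hsparse i
  have hc' : (0 : ℝ) < 3 / 4 * ℓ := by
    have : (1 : ℝ) ≤ ℓ := by exact_mod_cast hℓ
    positivity
  have hcl : boundary S Finset.univ = ∅ := boundary_univ_eq_empty_of_card_filter E htwo
  have hG' : ∀ i i' : Fin m, i ≠ i' → (S i ∩ S i').Nonempty → G.Adj i i' := fun i i' hne h =>
    (hG i i').2 ⟨hne, inter_supp_nonempty_of_inter_map_nonempty _ _ h⟩
  have key := mul_le_mul_treewidth_of_isBoundaryExpander hℓ' hc' hexp hcl G hG'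
  -- `3/4 ℓ (r-1)/2 ≤ ℓ (tw + 1)`, i.e. `3(r-1)/8 ≤ tw + 1`
  have hℓ0 : (0 : ℝ) < ℓ := by exact_mod_cast hℓ
  have htw : 3 * (r - 1) / 8 ≤ (treewidth G + 1 : ℕ) := by
    have key' : (ℓ : ℝ) * (3 * (r - 1) / 8) ≤ ℓ * (treewidth G + 1 : ℕ) := by
      calc (ℓ : ℝ) * (3 * (r - 1) / 8) = 3 / 4 * ℓ * (r - 1) / 2 := by ring
        _ ≤ _ := key
    exact le_of_mul_le_mul_left key' hℓ0
  push_cast at htw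
  -- consequences: `t₀ ≤ tw` and `r/4 ≤ tw`
  have htw₀ : t₀ ≤ treewidth G := by
    have : (t₀ : ℝ) ≤ treewidth G := by linarith
    exact_mod_cast this
  have htw4 : r / 4 ≤ (treewidth G : ℝ) := by linarith
  -- the weak treewidth bound
  have hsize := Ht n m E G htwo hG hconn htw₀ π hπ
  refine le_trans ?_ hsize
  -- `r^{ε/2} ≤ (r/4)^ε ≤ tw^ε`
  have h1 : r ^ (ε / 2) ≤ (r / 4) ^ ε := by
    have := rpow_le_rpow_div_four (e := ε / 2) hr16 (by positivity)
    convert this using 2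
    ring
  have h2 : (r / 4) ^ ε ≤ (treewidth G : ℝ) ^ ε := Real.rpow_le_rpow (by linarith) htw4 hε.le
  exact Real.rpow_le_rpow_of_exponent_le (by norm_num) (h1.trans h2)

end Summit.PneNP.PneNP.Theorems
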